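import Mathlib
import Summits.KontsevichZagierPeriods.Zeta5Search.KernelKit
import HarnessLib

/-!
# ζ(5) search — arithmetic of the five-parameter Catalan box (cell `pub-zeta5`, fam-denom D6, serving fam-catalan K1)
HONEST FRAMING: systematic search; no irrationality claim unless certified. (Filed for fam-denom by P2; one blank docstring line removed for the 400-line lint; mathematics byte-identical to the staged sha256 4f90e375….)

The family is `J(h,j,k,l,m) = ∫∫ x^{h−½}(1−x)^j y^l (1−y)^{k−½} (1−xy)^{−(j+k−m)−1} dx dy = Q·G + P`
(`Literature.NumberTheory.Irrationality.Nesterenko2016.Jsym`; fam-catalan's box CAT-RV5, `families/catalan/FAMILY.md`).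
The lane file `families/denom/CATK1.md` proves on paper (every instance machine-asserted on 2 836 exact rows)
Theorem A `2^{E₂−3}·Q ∈ ℤ`, `E₂ = 2(j+2k+l−h−m)`, from an explicit finite formula for `Q` whose summands are
super-Catalan numbers `S(k,b) = (2k)!(2b)!/(k! b! (k+b)!)`, Landau numbers `Λ(k,a) = (2k)! a!/((2a)! k! (k−a)!)`, the
dyadic numbers `F₁ = (T−l+½)_s/s!` and powers of `2`; and Theorem B (odd denominators of `P`, direction by direction).

PROVED here (no facts, no sorry), for ALL parameters:
* `superCatalan_isInt` — `S(k,b) ∈ ℤ`, by Gessel's recurrence `S(k,b+1) = 4S(k,b) − S(k+1,b)` from `S(k,0) = C(2k,k)`;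
* `landau_isInt` — `Λ'(a,m) := Λ(a+m,a) ∈ ℤ`, by the Pascal-type recurrence `Λ'(a+1,m+1) = Λ'(a,m+1) + 4Λ'(a+1,m)`;
* `op_two_pow_div_factorial_isInt` — `2^s·∏_{e<s}(2c+1+2e)/s! ∈ ℤ` for every INTEGER `c` (for `c ≥ 0` this is the
  integer `KrattenthalerRivoal2008.oddRun`; the point is `c < 0`, odd runs through zero), by a Pascal identity run
  downward in `c`; hence `F1_four_pow_isInt` — `4^s·F₁ ∈ ℤ` (CATK1.md Lemma L8);
* `theoremA_QClosed` — **`2^{E₂}·QClosed(h,j,k,l,m)/8 ∈ ℤ` for all `h j k l m`** (`E₂ = E2'`, the truncated-ℕ form of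
  `2((j+k−m)+k+l−h)`), and `QClosed_dyadic` — `QClosed ∈ ℤ[½]`.
DEFINED here: `QClosed h j k l m : ℚ` — Theorem A's finite sum (kernel-friendly structural recursion). That `QClosed`
equals the `G`-coefficient of `Jsym` is the partial-fraction computation of CATK1.md §1 (= fam-catalan's `QSUM.md`) and
is NOT typed here; the companion file `CatalanBoxCertificate.lean` checks `QClosed` against 22 exact rows of two
independent implementations by `decide` and shows the exponent `E₂ − 3` is attained. Nothing in this file is a
statement about Catalan's constant `G`.
-/

namespace Summit.KontsevichZagierPeriods.Zeta5Search.Denom.CatalanBox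

open Finset Summit.KontsevichZagierPeriods.Zeta5Search.KernelKit

/-! ### Super-Catalan numbers -/

/-- The super-Catalan number `S(k,b) = (2k)!(2b)!/(k! b! (k+b)!)` as a rational number. -/
def superCatalan (k b : ℕ) : ℚ :=
  ((2 * k).factorial : ℚ) * ((2 * b).factorial : ℚ) /
    ((k.factorial : ℚ) * (b.factorial : ℚ) * ((k + b).factorial : ℚ))

/-- `(2k)! = C(2k,k) · k! · k!` in `ℚ`. -/
theorem two_mul_factorial_eq (k : ℕ) :
    ((2 * k).factorial : ℚ) = ((2 * k).choose k : ℚ) * (k.factorial : ℚ) * (k.factorial : ℚ) := by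
  have h := Nat.choose_mul_factorial_mul_factorial (show k ≤ 2 * k by omega)
  rw [show 2 * k - k = k by omega] at h
  exact_mod_cast h.symm

/-- `S(k,0) = C(2k,k)`. -/
theorem superCatalan_zero (k : ℕ) : superCatalan k 0 = ((2 * k).choose k : ℚ) := by
  unfold superCatalan
  have hk : (k.factorial : ℚ) ≠ 0 := by positivity
  rw [two_mul_factorial_eq]
  simp only [mul_zero, Nat.factorial_zero, Nat.cast_one, mul_one, add_zero]
  rw [div_eq_iff (by positivity)]
  ring

/-- Gessel's recurrence `S(k,b+1) = 4·S(k,b) − S(k+1,b)`. -/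
theorem superCatalan_succ (k b : ℕ) :
    superCatalan k (b + 1) = 4 * superCatalan k b - superCatalan (k + 1) b := by
  unfold superCatalan
  have f1 : ((2 * (b + 1)).factorial : ℚ) = (2 * b + 2) * (2 * b + 1) * ((2 * b).factorial : ℚ) := by
    rw [show 2 * (b + 1) = (2 * b + 1) + 1 by ring, Nat.factorial_succ, Nat.factorial_succ]; push_cast; ring
  have f2 : ((b + 1).factorial : ℚ) = (b + 1) * (b.factorial : ℚ) := by
    rw [Nat.factorial_succ]; push_cast; ring
  have f3 : ((k + (b + 1)).factorial : ℚ) = (k + b + 1) * ((k + b).factorial : ℚ) := by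
    rw [show k + (b + 1) = (k + b) + 1 by ring, Nat.factorial_succ]; push_cast; ring
  have f4 : ((2 * (k + 1)).factorial : ℚ) = (2 * k + 2) * (2 * k + 1) * ((2 * k).factorial : ℚ) := by
    rw [show 2 * (k + 1) = (2 * k + 1) + 1 by ring, Nat.factorial_succ, Nat.factorial_succ]; push_cast; ring
  have f5 : ((k + 1).factorial : ℚ) = (k + 1) * (k.factorial : ℚ) := by
    rw [Nat.factorial_succ]; push_cast; ring
  have f6 : ((k + 1 + b).factorial : ℚ) = (k + b + 1) * ((k + b).factorial : ℚ) := by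
    rw [show k + 1 + b = (k + b) + 1 by ring, Nat.factorial_succ]; push_cast; ring
  rw [f1, f2, f3, f4, f5, f6]
  have hk : (k.factorial : ℚ) ≠ 0 := by positivity
  have hb : (b.factorial : ℚ) ≠ 0 := by positivity
  have hkb : ((k + b).factorial : ℚ) ≠ 0 := by positivity
  have h2k : ((2 * k).factorial : ℚ) ≠ 0 := by positivity
  have h2b : ((2 * b).factorial : ℚ) ≠ 0 := by positivity
  field_simp
  ring

/-- **Integrality of the super-Catalan numbers**: `S(k,b) = (2k)!(2b)!/(k! b! (k+b)!) ∈ ℤ` (E. Catalan 1874;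
I. Gessel, *Super ballot numbers*, J. Symbolic Comput. 14 (1992) 179–194). -/
theorem superCatalan_isInt : ∀ b k : ℕ, ∃ z : ℤ, superCatalan k b = z := by
  intro b
  induction b with
  | zero => intro k; exact ⟨((2 * k).choose k : ℕ), by rw [superCatalan_zero]; simp⟩
  | succ b ih =>
    intro k
    obtain ⟨z₁, h₁⟩ := ih k
    obtain ⟨z₂, h₂⟩ := ih (k + 1)
    exact ⟨4 * z₁ - z₂, by rw [superCatalan_succ, h₁, h₂]; push_cast; ring⟩

/-! ### Landau numbers -/

/-- The Landau number in the parametrisation `Λ'(a,m) := Λ(a+m, a) = (2a+2m)! a!/((2a)! (a+m)! m!)` (so that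
`Λ(k,a) = (2k)! a!/((2a)! k! (k−a)!) = C(2k,k)C(k,a)/C(2a,a) = Λ'(a, k−a)` for `a ≤ k`), as a rational number. -/
def landau (a m : ℕ) : ℚ :=
  ((2 * (a + m)).factorial : ℚ) * (a.factorial : ℚ) /
    (((2 * a).factorial : ℚ) * ((a + m).factorial : ℚ) * (m.factorial : ℚ))

/-- `Λ'(0,m) = C(2m,m)`. -/
theorem landau_zero_left (m : ℕ) : landau 0 m = ((2 * m).choose m : ℚ) := by
  unfold landau
  have hm : (m.factorial : ℚ) ≠ 0 := by positivity
  simp only [zero_add, mul_zero, Nat.factorial_zero, Nat.cast_one, mul_one, one_mul]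
  rw [two_mul_factorial_eq, div_eq_iff (by positivity)]
  ring

/-- `Λ'(a,0) = 1`. -/
theorem landau_zero_right (a : ℕ) : landau a 0 = 1 := by
  unfold landau
  have h1 : ((2 * a).factorial : ℚ) ≠ 0 := by positivity
  have h2 : (a.factorial : ℚ) ≠ 0 := by positivity
  simp only [add_zero, Nat.factorial_zero, Nat.cast_one, mul_one]
  rw [div_eq_iff (by positivity)]
  ring

/-- The Pascal-type recurrence `Λ'(a+1,m+1) = Λ'(a,m+1) + 4·Λ'(a+1,m)`
(= `KrattenthalerRivoal2008.oddRunQ_pascal` in the factorial parametrisation). -/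
theorem landau_succ_succ (a m : ℕ) :
    landau (a + 1) (m + 1) = landau a (m + 1) + 4 * landau (a + 1) m := by
  unfold landau
  have f1 : ((2 * (a + 1 + (m + 1))).factorial : ℚ)
      = (2 * a + 2 * m + 4) * (2 * a + 2 * m + 3) * ((2 * (a + (m + 1))).factorial : ℚ) := by
    rw [show 2 * (a + 1 + (m + 1)) = (2 * (a + (m + 1)) + 1) + 1 by ring, Nat.factorial_succ,
      Nat.factorial_succ]; push_cast; ring
  have f2 : ((a + 1).factorial : ℚ) = (a + 1) * (a.factorial : ℚ) := by
    rw [Nat.factorial_succ]; push_cast; ring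
  have f3 : ((2 * (a + 1)).factorial : ℚ) = (2 * a + 2) * (2 * a + 1) * ((2 * a).factorial : ℚ) := by
    rw [show 2 * (a + 1) = (2 * a + 1) + 1 by ring, Nat.factorial_succ, Nat.factorial_succ]; push_cast; ring
  have f4 : ((a + 1 + (m + 1)).factorial : ℚ) = (a + m + 2) * ((a + (m + 1)).factorial : ℚ) := by
    rw [show a + 1 + (m + 1) = (a + (m + 1)) + 1 by ring, Nat.factorial_succ]; push_cast; ring
  have f5 : ((m + 1).factorial : ℚ) = (m + 1) * (m.factorial : ℚ) := by
    rw [Nat.factorial_succ]; push_cast; ring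
  have f6 : ((2 * (a + 1 + m)).factorial : ℚ) = ((2 * (a + (m + 1))).factorial : ℚ) := by
    rw [show a + 1 + m = a + (m + 1) by ring]
  have f7 : ((a + 1 + m).factorial : ℚ) = ((a + (m + 1)).factorial : ℚ) := by
    rw [show a + 1 + m = a + (m + 1) by ring]
  rw [f1, f2, f3, f4, f5, f6, f7]
  have h1 : ((2 * a).factorial : ℚ) ≠ 0 := by positivity
  have h2 : (a.factorial : ℚ) ≠ 0 := by positivity
  have h3 : ((a + (m + 1)).factorial : ℚ) ≠ 0 := by positivity
  have h4 : (m.factorial : ℚ) ≠ 0 := by positivity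
  have h5 : ((2 * (a + (m + 1))).factorial : ℚ) ≠ 0 := by positivity
  field_simp
  ring

/-- **Integrality of the Landau numbers**: `Λ(a+m, a) = (2a+2m)! a!/((2a)! (a+m)! m!) ∈ ℤ` for all `a, m`
(E. Landau, Nouv. Ann. Math. (3) 19 (1900) 344–362: `C(2a,a) ∣ C(2k,k)·C(k,a)`; the same integer as
`KrattenthalerRivoal2008.oddRun a m`, cf. `Zudilin2003.four_pow_mul_poch_half`). -/
theorem landau_isInt : ∀ m a : ℕ, ∃ z : ℤ, landau a m = z := by
  intro m
  induction m with
  | zero => intro a; exact ⟨1, by rw [landau_zero_right]; simp⟩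
  | succ m ihm =>
    intro a
    induction a with
    | zero => exact ⟨((2 * (m + 1)).choose (m + 1) : ℕ), by rw [landau_zero_left]; simp⟩
    | succ a iha =>
      obtain ⟨z₁, h₁⟩ := iha
      obtain ⟨z₂, h₂⟩ := ihm (a + 1)
      exact ⟨z₁ + 4 * z₂, by rw [landau_succ_succ, h₁, h₂]; push_cast; ring⟩

/-! ### Theorem A's finite sum (kernel-friendly) -/

/-- `∏_{e < s} (2T − 2l + 1 + 2e)` by structural recursion on `s`. -/
def oddProd (T : ℤ) (l : ℕ) : ℕ → ℤ
  | 0 => 1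
  | s + 1 => oddProd T l s * (2 * T - 2 * (l : ℤ) + 1 + 2 * (s : ℤ))

/-- `F₁(T) = (T − l + ½)_s / s! = (∏_{e<s}(2T − 2l + 1 + 2e)) / (2^s · s!)` at an integer `T` (CATK1.md §1). -/
def F1 (T : ℤ) (l s : ℕ) : ℚ := (oddProd T l s : ℚ) / ((2 : ℚ) ^ s * (s.factorial : ℚ))

/-- The summand of Theorem A's formula at the index `i ∈ [0, j]`, `a := h − l + i`, `s := j + k − m`:
for `a ≤ 0` (write `b = −a`) the type-A term `8(−1)^i C(j,i)·F₁(−a)·S(k,b)·4^{−k−b}`; for `1 ≤ a ≤ k` the type-C term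
`−8(−1)^i C(j,i)·(−1)^{a−1}Λ(k,a)·4^{a−k}·F₁(−a)`; zero for `a > k`. -/
def qTerm (h j k l m i : ℕ) : ℚ :=
  let s := j + k - m
  let a : ℤ := (h : ℤ) - (l : ℤ) + (i : ℤ)
  let c : ℚ := (-1 : ℚ) ^ i * (binomF j i : ℚ)
  if a ≤ 0 then
    8 * c * F1 (-a) l s * superCatalan k (-a).toNat / (4 : ℚ) ^ (k + (-a).toNat)
  else if a ≤ (k : ℤ) then
    -8 * c * (-1 : ℚ) ^ (a.toNat - 1) * landau a.toNat (k - a.toNat) * (4 : ℚ) ^ a.toNat / (4 : ℚ) ^ k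
      * F1 (-a) l s
  else 0

/-- `qSum h j k l m i = Σ_{i' ≤ i} qTerm … i'` by structural recursion. -/
def qSum (h j k l m : ℕ) : ℕ → ℚ
  | 0 => qTerm h j k l m 0
  | i + 1 => qSum h j k l m i + qTerm h j k l m (i + 1)

/-- **Theorem A's explicit finite formula** for the `G`-coefficient `Q(h,j,k,l,m)` of `Jsym h j k l m`
(`j + k ≥ m`; CATK1.md §0, fam-catalan QSUM.md): `QClosed = Σ_{i=0}^{j} qTerm(i)`. A DEFINITION — its identification
with the `G`-coefficient is NOT typed here (see `qRows_checked` for the kernel cross-check against exact data). -/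
def QClosed (h j k l m : ℕ) : ℚ := qSum h j k l m j

/-- `E₂ = 2(j + 2k + l − h − m)` (truncated subtraction; meaningful when `h + m ≤ j + 2k + l`). -/
def E2 (h j k l m : ℕ) : ℕ := 2 * (j + 2 * k + l) - 2 * (h + m)

/-! ### Theorem A for `QClosed` in general: `2^{E₂−3}·QClosed ∈ ℤ` (hence `QClosed ∈ ℤ[½]`)

The remaining brick is the dyadicity of `F₁`: `4^s·(T − l + ½)_s/s! ∈ ℤ` for EVERY integer `T` (CATK1.md L8). We prove
it through the odd-run numbers `op c s = ∏_{e<s}(2c+1+2e)` (`c ∈ ℤ`): `2^s·op(c,s)/s! ∈ ℤ` for all `c ∈ ℤ` — for `c ≥ 0`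
this is `KrattenthalerRivoal2008.oddRun_eq`; the extension to negative `c` (odd runs through or below zero, which is
the typical case in `QClosed`) follows from the Pascal-type identity `op(c+1,s+1) = op(c,s+1) + 2(s+1)·op(c+1,s)` run
DOWNWARD in `c`, with the base column `2^s·op(0,s)/s! = C(2s,s)`. -/

/-- The odd run `op c s = ∏_{e<s} (2c + 1 + 2e)` for an INTEGER start parameter `c` (structural recursion on `s`). -/
def op (c : ℤ) : ℕ → ℤ
  | 0 => 1
  | s + 1 => op c s * (2 * c + 1 + 2 * (s : ℤ))

/-- `oddProd T l s = op (T − l) s`. -/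
theorem oddProd_eq_op (T : ℤ) (l s : ℕ) : oddProd T l s = op (T - l) s := by
  induction s with
  | zero => rfl
  | succ s ih => simp only [oddProd, op, ih]; ring

/-- Shift identity `op(c+1,s)·(2c+1) = op(c,s)·(2c+1+2s)`. -/
theorem op_shift (c : ℤ) (s : ℕ) : op (c + 1) s * (2 * c + 1) = op c s * (2 * c + 1 + 2 * (s : ℤ)) := by
  induction s with
  | zero => simp [op]
  | succ s ih =>
    simp only [op]
    push_cast
    linear_combination (2 * c + 3 + 2 * (s : ℤ)) * ih

/-- Pascal-type identity `op(c+1,s+1) = op(c,s+1) + 2(s+1)·op(c+1,s)`. -/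
theorem op_pascal (c : ℤ) (s : ℕ) : op (c + 1) (s + 1) = op c (s + 1) + 2 * ((s : ℤ) + 1) * op (c + 1) s := by
  simp only [op]
  linear_combination op_shift c s

/-- Base column: `2^s · op(0,s) = (2s)!/s!`, i.e. `op(0,s)·2^s·s! = (2s)!`. -/
theorem op_zero_mul (s : ℕ) : (op 0 s : ℚ) * 2 ^ s * (s.factorial : ℚ) = ((2 * s).factorial : ℚ) := by
  induction s with
  | zero => simp [op]
  | succ s ih =>
    have f1 : ((2 * (s + 1)).factorial : ℚ) = (2 * s + 2) * (2 * s + 1) * ((2 * s).factorial : ℚ) := by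
      rw [show 2 * (s + 1) = (2 * s + 1) + 1 by ring, Nat.factorial_succ, Nat.factorial_succ]; push_cast; ring
    rw [f1, ← ih, Nat.factorial_succ, op]
    push_cast
    ring

/-- **Dyadic odd runs**: `2^s · op(c,s)/s! ∈ ℤ` for every integer `c` and every `s` (for `c ≥ 0` this is the
integer `KrattenthalerRivoal2008.oddRun c s`; the point is `c < 0`). -/
theorem op_two_pow_div_factorial_isInt (c : ℤ) : ∀ s : ℕ, ∃ z : ℤ, (op c s : ℚ) * 2 ^ s / (s.factorial : ℚ) = z := by
  induction c using Int.induction_on with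
  | zero =>
    intro s
    refine ⟨((2 * s).choose s : ℕ), ?_⟩
    have hs : (s.factorial : ℚ) ≠ 0 := by positivity
    have h3 := op_zero_mul s
    rw [two_mul_factorial_eq] at h3
    rw [div_eq_iff hs]
    push_cast
    refine mul_right_cancel₀ hs ?_
    linear_combination h3
  | succ n ih =>
    intro s
    induction s with
    | zero => exact ⟨1, by simp [op]⟩
    | succ s ihs =>
      obtain ⟨z₁, h₁⟩ := ih (s + 1)
      obtain ⟨z₂, h₂⟩ := ihs
      refine ⟨z₁ + 4 * z₂, ?_⟩
      have hs : (s.factorial : ℚ) ≠ 0 := by positivity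
      have hs1 : ((s + 1).factorial : ℚ) ≠ 0 := by positivity
      have e1 : (op (↑n) (s + 1) : ℚ) * 2 ^ (s + 1) = z₁ * ((s + 1).factorial : ℚ) := by
        rw [← h₁, div_mul_cancel₀ _ hs1]
      have e2 : (op (↑n + 1) s : ℚ) * 2 ^ s = z₂ * (s.factorial : ℚ) := by
        rw [← h₂, div_mul_cancel₀ _ hs]
      rw [div_eq_iff hs1, op_pascal]
      have f : ((s + 1).factorial : ℚ) = (s + 1) * (s.factorial : ℚ) := by
        rw [Nat.factorial_succ]; push_cast; ring
      rw [f] at e1 ⊢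
      push_cast
      linear_combination e1 + 4 * ((s : ℚ) + 1) * e2
  | pred n ih =>
    intro s
    cases s with
    | zero => exact ⟨1, by simp [op]⟩
    | succ s =>
      obtain ⟨z₁, h₁⟩ := ih (s + 1)
      obtain ⟨z₂, h₂⟩ := ih s
      refine ⟨z₁ - 4 * z₂, ?_⟩
      have hs : (s.factorial : ℚ) ≠ 0 := by positivity
      have hs1 : ((s + 1).factorial : ℚ) ≠ 0 := by positivity
      have e1 : (op (-↑n) (s + 1) : ℚ) * 2 ^ (s + 1) = z₁ * ((s + 1).factorial : ℚ) := by
        rw [← h₁, div_mul_cancel₀ _ hs1]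
      have e2 : (op (-↑n) s : ℚ) * 2 ^ s = z₂ * (s.factorial : ℚ) := by
        rw [← h₂, div_mul_cancel₀ _ hs]
      have hp := op_pascal (-↑n - 1) s
      rw [show (-↑n - 1 + 1 : ℤ) = -↑n by ring] at hp
      -- hp : op (-n) (s+1) = op (-n-1) (s+1) + 2(s+1) op (-n) s
      rw [div_eq_iff hs1]
      have f : ((s + 1).factorial : ℚ) = (s + 1) * (s.factorial : ℚ) := by
        rw [Nat.factorial_succ]; push_cast; ring
      rw [f] at e1 ⊢
      have hp' : (op (-↑n - 1) (s + 1) : ℚ) = (op (-↑n) (s + 1) : ℚ) - 2 * ((s : ℚ) + 1) * (op (-↑n) s : ℚ) := by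
        have := congrArg (fun x : ℤ => (x : ℚ)) hp
        push_cast at this
        linear_combination (-1 : ℚ) * this
      push_cast
      linear_combination (2 : ℚ) ^ (s + 1) * hp' + e1 - 4 * ((s : ℚ) + 1) * e2

/-- **Lemma L8 (dyadicity of `F₁`)**: `4^s · F₁(T) ∈ ℤ` for every integer `T`, i.e. `(T − l + ½)_s/s! ∈ 2^{−2s}ℤ`. -/
theorem F1_four_pow_isInt (T : ℤ) (l s : ℕ) : ∃ z : ℤ, F1 T l s = (z : ℚ) / 4 ^ s := by
  obtain ⟨z, hz⟩ := op_two_pow_div_factorial_isInt (T - l) s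
  refine ⟨z, ?_⟩
  unfold F1
  rw [oddProd_eq_op, ← hz]
  have hs : (s.factorial : ℚ) ≠ 0 := by positivity
  have h4 : (4 : ℚ) ^ s = 2 ^ s * 2 ^ s := by rw [← mul_pow]; norm_num
  rw [h4]
  field_simp

/-- The exponent `E₂ = 2(s + k + l − h)`, `s = j + k − m`, as a natural number (truncated; it is the true `E₂` of
CATK1.md whenever `m ≤ j + k` and some summand of `QClosed` is non-zero). -/
def E2' (h j k l m : ℕ) : ℕ := 2 * ((j + k - m) + k + l) - 2 * h

/-- Every summand of Theorem A's formula satisfies `2^{E₂−3}·qTerm ∈ ℤ`: precisely `qTerm = w·8/2^{E₂}` with `w ∈ ℤ`. -/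
theorem qTerm_bound (h j k l m i : ℕ) :
    ∃ w : ℤ, qTerm h j k l m i = (w : ℚ) * 8 / 2 ^ E2' h j k l m := by
  unfold qTerm E2'
  set s := j + k - m with hs_def
  set a : ℤ := (h : ℤ) - (l : ℤ) + (i : ℤ) with ha_def
  by_cases ha : a ≤ 0
  · -- type A: b = -a = l - h - i ≥ 0
    rw [if_pos ha]
    obtain ⟨z₁, h₁⟩ := F1_four_pow_isInt (-a) l s
    obtain ⟨z₂, h₂⟩ := superCatalan_isInt (-a).toNat k
    have hb : ((-a).toNat : ℤ) = -a := Int.toNat_of_nonneg (by omega)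
    have hN : 2 * (s + k + l) - 2 * h = 2 * (s + (k + (-a).toNat) + i) := by omega
    refine ⟨(-1) ^ i * (binomF j i : ℤ) * z₁ * z₂ * 4 ^ i, ?_⟩
    rw [h₁, h₂, hN, pow_mul, show ((2 : ℚ) ^ 2) = 4 by norm_num, pow_add, pow_add]
    push_cast
    field_simp
    ring
  · rw [if_neg ha]
    by_cases hak : a ≤ (k : ℤ)
    · -- type C: 1 ≤ a ≤ k
      rw [if_pos hak]
      obtain ⟨z₁, h₁⟩ := F1_four_pow_isInt (-a) l s
      obtain ⟨z₂, h₂⟩ := landau_isInt (k - a.toNat) a.toNat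
      have ha' : (a.toNat : ℤ) = a := Int.toNat_of_nonneg (by omega)
      have hN : 2 * (s + k + l) - 2 * h + 2 * a.toNat = 2 * (i + k + s) := by omega
      refine ⟨-((-1) ^ i * (binomF j i : ℤ)) * (-1) ^ (a.toNat - 1) * z₁ * z₂ * 4 ^ i, ?_⟩
      rw [h₁, h₂]
      have key : (2 : ℚ) ^ (2 * (s + k + l) - 2 * h) * 4 ^ a.toNat = 4 ^ i * 4 ^ k * 4 ^ s := by
        have : (4 : ℚ) = 2 ^ 2 := by norm_num
        rw [this, ← pow_mul, ← pow_mul, ← pow_mul, ← pow_mul, ← pow_add, ← pow_add, ← pow_add]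
        congr 1
        omega
      have h4k : (4 : ℚ) ^ k ≠ 0 := by positivity
      have h4s : (4 : ℚ) ^ s ≠ 0 := by positivity
      have h2N : (2 : ℚ) ^ (2 * (s + k + l) - 2 * h) ≠ 0 := by positivity
      rw [eq_div_iff h2N]
      field_simp
      push_cast
      linear_combination (-((-1) ^ i * (binomF j i : ℚ) * (-1) ^ (a.toNat - 1) * (z₂ : ℚ) * (z₁ : ℚ))) * key
    · rw [if_neg hak]
      exact ⟨0, by simp⟩

/-- Partial sums: `2^{E₂−3}·qSum ∈ ℤ`. -/
theorem qSum_bound (h j k l m : ℕ) : ∀ i : ℕ, ∃ w : ℤ, qSum h j k l m i = (w : ℚ) * 8 / 2 ^ E2' h j k l m := by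
  intro i
  induction i with
  | zero => simpa [qSum] using qTerm_bound h j k l m 0
  | succ i ih =>
    obtain ⟨w₁, h₁⟩ := ih
    obtain ⟨w₂, h₂⟩ := qTerm_bound h j k l m (i + 1)
    exact ⟨w₁ + w₂, by rw [qSum, h₁, h₂]; push_cast; ring⟩

/-- **Theorem A (CATK1.md), Lean form for the explicit sum.** For all `h j k l m`:
`2^{E₂} · QClosed(h,j,k,l,m) / 8 ∈ ℤ`, `E₂ = 2((j+k−m) + k + l − h)` — i.e. `2^{E₂−3}·Q ∈ ℤ` for the finite formula `Q`
of the `G`-coefficient. (That `QClosed` IS the `G`-coefficient of `Jsym` is not typed here; `qRows_checked` certifies it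
on 22 exact rows.) In particular the denominator of `QClosed` is a power of `2`. -/
theorem theoremA_QClosed (h j k l m : ℕ) :
    ∃ z : ℤ, (z : ℚ) = 2 ^ E2' h j k l m * QClosed h j k l m / 8 := by
  obtain ⟨w, hw⟩ := qSum_bound h j k l m j
  refine ⟨w, ?_⟩
  unfold QClosed
  rw [hw]
  have h2 : (2 : ℚ) ^ E2' h j k l m ≠ 0 := by positivity
  field_simp

/-- **Corollary (K1, Q-half, odd part): `QClosed ∈ ℤ[½]`** — no odd prime divides the denominator of Theorem A's sum. -/
theorem QClosed_dyadic (h j k l m : ℕ) : ∃ z : ℤ, ∃ e : ℕ, QClosed h j k l m = (z : ℚ) / 2 ^ e := by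
  obtain ⟨w, hw⟩ := qSum_bound h j k l m j
  exact ⟨w * 8, E2' h j k l m, by unfold QClosed; rw [hw]; push_cast; ring⟩

/-- `E2' = E2` when `m ≤ j + k` and `h + m ≤ j + 2k + l` (no truncation). -/
theorem E2'_eq_E2 {h j k l m : ℕ} (hm : m ≤ j + k) (hh : h + m ≤ j + 2 * k + l) :
    E2' h j k l m = E2 h j k l m := by unfold E2' E2; omega

end Summit.KontsevichZagierPeriods.Zeta5Search.Denom.CatalanBox
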